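import Summits.CriticalPhenomena.Ising3DConformalLimit.Theses.ModularQuarterTurn

/-!
# CriticalPhenomena / Ising3DConformalLimit — route ModularQuarterTurn, assembly

Settles item `stmt-CriticalPhenomena-11215` (rank 1, assembly of route
`route-CriticalPhenomena-ModularQuarterTurn`):

`ExistsScaleCovariantLimit → WedgeModularRotation → AxialRotationUpgrade → BallModularMoebius →
ToroidalInversionUpgrade → IsingEuclidUpgradeR4NonGaussian → Ising3DConformalLimit`.

Pure logic plus uniqueness of locally uniform limits over the summit's structure predicates
(`Literature/Probability/LatticeModels/ConformalCovariance.lean`,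
`Literature/Probability/LatticeModels/ScalingLimit3D.lean`): take `ρ, Δ, S` from (E₀)
`ExistsScaleCovariantLimit`; (LBW) `WedgeModularRotation` gives a box growth `L` and, for each
`n`, locally uniform convergence (as `δ → 0⁺`) of the angle-interpolated lattice words to
`S n ∘ cyl` on the wedge domain; the word does not contain the offset `c` and the membership
conditions of the domain do not involve `c`, so `TendstoLocallyUniformlyOn.tendsto_at` at
`(c, p)` and at `(c', p)` are two limits of the same function along `𝓝[>] 0` (a `NeBot` filter)
and `tendsto_nhds_unique` gives `S n (cyl (c, p)) = S n (cyl (c', p))`;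
`AxialRotationUpgrade` turns this into `IsRotationInvariant S`, hence
`IsEuclideanInvariant S := ⟨transl, rot⟩`. (LCHM) `BallModularMoebius` (whose extra hypothesis is
Euclidean invariance) and the same uniqueness argument give offset-independence of
`(∏ J)^Δ · S n ∘ M`, and `ToroidalInversionUpgrade` yields `IsInversionCovariant Δ S`;
`IsMoebiusCovariant Δ S := ⟨Euclid, scale, inversion⟩` by definition; (NG)
`IsingEuclidUpgradeR4NonGaussian` gives `HasNontrivialU4 S`; conclude
`CritIsing3DConformalLimit` (= `Ising3DConformalLimit`). No named facts are used; the theorem is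
unconditional bookkeeping (the body of the route's deciding theorem `closes`).
-/

namespace Summit.CriticalPhenomena.Ising3DConformalLimit.Theorems

open Summit.CriticalPhenomena.Ising3DConformalLimit.Theses.ModularQuarterTurn
open Literature.Probability.LatticeModels
open Filter Topology

/-- Settles `stmt-CriticalPhenomena-11215` (exact signature): the assembly
`ExistsScaleCovariantLimit → WedgeModularRotation → AxialRotationUpgrade → BallModularMoebius →
ToroidalInversionUpgrade → IsingEuclidUpgradeR4NonGaussian → Ising3DConformalLimit` of route
ModularQuarterTurn. Proof: `ρ, Δ, S` from (E₀); (LBW) + uniqueness of limits along `𝓝[>] 0`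
(the interpolated word and the wedge domain do not contain the offset `c`) + `AxialRotationUpgrade`
⇒ `IsRotationInvariant S`; Euclidean := ⟨transl, rot⟩; (LCHM) + the same uniqueness argument +
`ToroidalInversionUpgrade` ⇒ inversion covariance; Möbius := ⟨Euclid, scale, inversion⟩
(definition of `IsMoebiusCovariant`, Di Francesco–Mathieu–Sénéchal 1997 §4.3.1); (NG) ⇒ `U₄ ≢ 0`.
[folklore] -/
theorem modularQuarterTurn_assembly_proof :
    Summit.CriticalPhenomena.Ising3DConformalLimit.Theses.ModularQuarterTurn.Assembly := by
  unfold Assembly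
  intro hE0 hLBW hAx hLCHM hTor hNG
  obtain ⟨ρ, Δ, S, hρ, hΔ, hlim, hnorm, hnd, htr, hsc⟩ := hE0
  -- (LBW) + bookkeeping ⇒ rotation invariance
  have hrot : IsRotationInvariant S := by
    obtain ⟨L, hL⟩ := hLBW ρ Δ S hρ hΔ hlim hnorm hnd htr hsc
    refine hAx ρ Δ S hρ hΔ hlim hnorm hnd htr hsc ?_
    intro n c c' p hcp
    have hc'p := hcp
    exact tendsto_nhds_unique ((hL n).tendsto_at hcp) ((hL n).tendsto_at (a := (c', p)) hc'p)
  have heuc : IsEuclideanInvariant S := ⟨htr, hrot⟩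
  -- (LCHM) + bookkeeping ⇒ inversion covariance
  have hinv : IsInversionCovariant Δ S := by
    refine hTor ρ Δ S hρ hΔ hlim hnorm hnd heuc hsc ?_
    intro r hr n c c' p hcp
    obtain ⟨L, hL⟩ := hLCHM ρ Δ S hρ hΔ hlim hnorm hnd heuc hsc r hr
    have hc'p := hcp
    exact tendsto_nhds_unique ((hL n).tendsto_at hcp) ((hL n).tendsto_at (a := (c', p)) hc'p)
  have hmoeb : IsMoebiusCovariant Δ S := ⟨heuc, hsc, hinv⟩
  have hU4 : HasNontrivialU4 S := hNG ρ S hρ hlim hnd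
  exact ⟨ρ, Δ, S, hρ, hΔ, hlim, hnd, hmoeb, hU4⟩

end Summit.CriticalPhenomena.Ising3DConformalLimit.Theorems
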